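import Mathlib
import HarnessLib
import Summits.HubbardSuperconductivity.HubbardSuperconductivity.Theorems.KLProgrammeC4aPPKernelFirstOrderRows
import Summits.HubbardSuperconductivity.HubbardSuperconductivity.Theorems.KLProgrammeC4aKernelBumpRows
import Summits.HubbardSuperconductivity.HubbardSuperconductivity.Theorems.KLProgrammeC4aKernelBumpRowsWeighted

/-!
# Route `KLProgramme` — crux C4a, S3 brick (B4) «(U1)-HYBRID», «SWAP-BY-SYMMETRY» kernel side: U7's FOURTEEN KERNEL ROWS FOR THE BUMPED FAR PIECE
# `Kr e u := χ(u)·(A_s(e,u)/C)/Cχ` — the partner's level bump absorbed into the kernel family (pen (R529)(A): `U = 2·U_A + U_M`)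

Cell `gate-hubbard-kl`, seat hubbard-kl-k3c3-p1 (g19; row «δμ-flow with klAngularMean constant piece»).  Composition of this seat's `ppFarKernelS_rows` / `farSRow_hK0s` /
`farS_hflat_row` (✓ `…PPKernelFarSBundle`, `…FarSFlatnessRow`) with k3c3-p3 g38's product-rule transfer lemmas (✓ `…C4aKernelBumpRows`, ✓ `…C4aKernelBumpRowsWeighted`).
* `continuous_ppFarKernelS_value₂` — joint continuity of the VALUE `A_s` (the transfer's `hKc0`);
* **`bumpKernel_hKn1_cutoff`** — the negative-level transfer with the bump's OUTER cut (`χ′ = 0` on `|u| ≥ Rχ` as well as on `|u| ≤ rχ`): then the value majorant is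
  needed only on `rχ < |u| < Rχ`, where `max(u−s, lo) ≤ Rχ`, so the plain value row `|Kr(−s) u| ≤ s⁻¹` (from `hK0`) suffices: `ρm ↦ (ρm + Bχ₁·Rχ²/s)/Cχ` (located row
  «BUMP-HKN0-UNBOUNDED» of this seat on `bumpKernel_hKn1`, whose `hKn0` is unsatisfiable for the far piece as `u → ∞`);
* `bump_ρv_rows` — `ρv s := Rχ²/s`: `0 ≤`, continuous on `[lo,hi]`, tail `∫_a^{hi} ρv ≤ (Rχ²hi²/lo³)·lo·(lo/a)²`;
* **`ppFarKernelSBump_rows`** — the fourteen rows `hKd hK2d hK0 hK0s hK1 hK2 hsupp hKc hflat hKn1 hρ0 hρc hρtail hKs1` of `umkLoopCircle_integral_le_canonical` for the bumped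
  family, with `Afl := (W·X_A/C)/Cχ`, `Bfl := ((W′+W·Bχ₁)·C₁ᴬt₁²/((1−t₁)²C) + W·Bχ₁·rχ⁻¹·(hi−lo))/Cχ`, `ρm := (ρᶠ/C + Bχ₁Rχ²/s)/Cχ`, `Mρ := (Mρᶠ/C + Bχ₁Rχ²hi²/lo³)/Cχ`,
  `q_s := (1−t₁)/t₁`, `Dfl := hi/t₁`; bump data: `χ ∈ C²`, `|χ| ≤ 1`, `|χ′| ≤ Bχ₁`, `|χ″| ≤ Bχ₂`, `χ′ = 0` on `|u| ≤ rχ` (`0 < rχ`) and `χ′ = χ″ = 0` on `|u| ≥ Rχ`,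
  `lo ≤ hi ≤ Rχ`, `1 + 2Bχ₁Rχ + Bχ₂Rχ² ≤ Cχ`.
Pure real analysis / composition; nothing asserts (C), K3, the window or superconductivity.
References: BGM 2006 §2.4 (2.36) [cite: BenfattoGiulianiMastropietro2006]; FST II CPAM 51 (1998) §3 [cite: FeldmanSalmhoferTrubowitz1998].
-/

noncomputable section

namespace Summit.HubbardSuperconductivity.HubbardSuperconductivity.Theorems.C4a

set_option linter.dupNamespace false -- summit = problem name (single-conjunct summit), D-0017

open Real Set Filter MeasureTheory intervalIntegral
open scoped Topology Interval
open Literature.MathematicalPhysics.QuantumLattice Literature.Analysis.SpecialFunctions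

/-! ## §1 Kernel-agnostic pieces -/

/-- **Joint continuity of the far piece's VALUE** `(e,u) ↦ A_s(e,u)`. [cite: BenfattoGiulianiMastropietro2006, §2.4 (2.36)] -/
theorem continuous_ppFarKernelS_value₂ {β Λ : ℝ} (hβ : 0 < β) {κ : ℝ → ℝ} (hκc : Continuous κ) {lo : ℝ} (hlo : 0 < lo) :
    Continuous fun p : ℝ × ℝ => ppFarKernelS β Λ κ lo p.1 p.2 := by
  unfold ppFarKernelS
  exact (continuous_ppTrueKernel_comp hβ Λ continuous_fst continuous_snd).mul (hκc.comp (continuous_ppSmoothRatio₂ hlo))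

set_option maxHeartbeats 400000 in
/-- **NEGATIVE-LEVEL TRANSFER WITH THE OUTER CUT**: if `χ′ = 0` on `|u| ≤ rχ` AND on `|u| ≥ Rχ`, `lo ≤ hi ≤ Rχ`, `1 ≤ Cχ`, and the family satisfies `hKn1` (majorant `ρm`) and
the plain value row `|Kr(−s) u| ≤ s⁻¹` (`s ∈ [lo,hi]`), then the bumped family satisfies `hKn1` with `ρm ↦ (ρm + Bχ₁·Rχ²/s)/Cχ`. [folklore] -/
theorem bumpKernel_hKn1_cutoff {χ : ℝ → ℝ} (hχ : ContDiff ℝ 2 χ) {Bχ₁ rχ Rχ : ℝ} (hχ0 : ∀ u, |χ u| ≤ 1) (hχ1 : ∀ u, |deriv χ u| ≤ Bχ₁)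
    (hχ1r : ∀ u, |u| ≤ rχ → deriv χ u = 0) (hχ1z : ∀ u, Rχ ≤ |u| → deriv χ u = 0) {Kr : ℝ → ℝ → ℝ} {lo hi Cχ : ℝ} (hlo : 0 < lo)
    (hlohi : lo ≤ hi) (hhiR : hi ≤ Rχ) (hC1 : 1 ≤ Cχ) (hKdiff : ∀ e, Differentiable ℝ (Kr e)) {ρm : ℝ → ℝ}
    (hKn1 : ∀ s ∈ Icc lo hi, ∀ u, s / 2 ≤ u → |deriv (Kr (-s)) u| ≤ ρm s * ((max (u - s) lo)⁻¹ ^ 2))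
    (hKv : ∀ s ∈ Icc lo hi, ∀ u, |Kr (-s) u| ≤ s⁻¹) :
    ∀ s ∈ Icc lo hi, ∀ u, s / 2 ≤ u → |deriv (fun v => χ v * Kr (-s) v / Cχ) u| ≤ (ρm s + Bχ₁ * (Rχ ^ 2 / s)) / Cχ * ((max (u - s) lo)⁻¹ ^ 2) :=
  fun s hs u hu => by
  have hχd : Differentiable ℝ χ := hχ.differentiable (by norm_num)
  have hC0 : 0 < Cχ := by linarith
  have hB1 : 0 ≤ Bχ₁ := (abs_nonneg _).trans (hχ1 0)
  have hs0 : 0 < s := hlo.trans_le hs.1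
  have hm0 : 0 < max (u - s) lo := lt_max_of_lt_right hlo
  have hρm0 : 0 ≤ ρm s := by
    have h := hKn1 s hs u hu
    have hx : 0 < (max (u - s) lo)⁻¹ ^ 2 := by positivity
    nlinarith [abs_nonneg (deriv (Kr (-s)) u)]
  rw [deriv_bumpKernel hχd (hKdiff (-s)), abs_div, abs_of_pos hC0, div_mul_eq_mul_div]
  refine div_le_div_of_nonneg_right ?_ hC0.le
  have hA : |deriv χ u * Kr (-s) u| ≤ Bχ₁ * (Rχ ^ 2 / s) * ((max (u - s) lo)⁻¹ ^ 2) := by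
    rcases le_or_gt |u| rχ with hur | hur
    · rw [hχ1r u hur, zero_mul, abs_zero]; positivity
    rcases le_or_gt Rχ |u| with huR | huR
    · rw [hχ1z u huR, zero_mul, abs_zero]; positivity
    have hmR : max (u - s) lo ≤ Rχ := max_le (by linarith [le_abs_self u]) (hlohi.trans hhiR)
    have h1 : 1 ≤ Rχ ^ 2 * (max (u - s) lo)⁻¹ ^ 2 := by
      rw [← mul_pow]
      have h0 : 1 ≤ Rχ * (max (u - s) lo)⁻¹ := by rw [le_mul_inv_iff₀ hm0, one_mul]; exact hmR
      exact one_le_pow₀ h0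
    have hconv : s⁻¹ ≤ Rχ ^ 2 / s * (max (u - s) lo)⁻¹ ^ 2 := by
      calc s⁻¹ = s⁻¹ * 1 := (mul_one _).symm
        _ ≤ s⁻¹ * (Rχ ^ 2 * (max (u - s) lo)⁻¹ ^ 2) := mul_le_mul_of_nonneg_left h1 (inv_nonneg.2 hs0.le)
        _ = Rχ ^ 2 / s * (max (u - s) lo)⁻¹ ^ 2 := by rw [div_eq_mul_inv]; ring
    rw [abs_mul]
    calc |deriv χ u| * |Kr (-s) u| ≤ Bχ₁ * s⁻¹ := mul_le_mul (hχ1 u) (hKv s hs u) (abs_nonneg _) hB1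
      _ ≤ Bχ₁ * (Rχ ^ 2 / s * (max (u - s) lo)⁻¹ ^ 2) := mul_le_mul_of_nonneg_left hconv hB1
      _ = _ := by ring
  have hB : |χ u * deriv (Kr (-s)) u| ≤ 1 * (ρm s * ((max (u - s) lo)⁻¹ ^ 2)) := by
    rw [abs_mul]; exact mul_le_mul (hχ0 u) (hKn1 s hs u hu) (abs_nonneg _) zero_le_one
  calc |deriv χ u * Kr (-s) u + χ u * deriv (Kr (-s)) u| ≤ Bχ₁ * (Rχ ^ 2 / s) * ((max (u - s) lo)⁻¹ ^ 2) + 1 * (ρm s * ((max (u - s) lo)⁻¹ ^ 2)) :=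
        (abs_add_le _ _).trans (add_le_add hA hB)
    _ = (ρm s + Bχ₁ * (Rχ ^ 2 / s)) * (max (u - s) lo)⁻¹ ^ 2 := by ring

/-- **The value majorant `ρv s := Rχ²/s`**: nonnegative, continuous on `[lo,hi]`, tail `∫_a^{hi} Rχ²/s ds ≤ (Rχ²·hi²/lo³)·(lo·(lo/a)²)` (`0 < lo ≤ a ≤ hi`). [folklore] -/
theorem bump_ρv_rows {lo hi Rχ : ℝ} (hlo : 0 < lo) (hlohi : lo ≤ hi) :
    (∀ s ∈ Icc lo hi, 0 ≤ Rχ ^ 2 / s) ∧ ContinuousOn (fun s : ℝ => Rχ ^ 2 / s) (Icc lo hi) ∧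
      ∀ a ∈ Icc lo hi, ∫ s in a..hi, Rχ ^ 2 / s ≤ Rχ ^ 2 * hi ^ 2 / lo ^ 3 * (lo * (lo / a) ^ 2) := by
  refine ⟨?_, ?_, fun a ha => ?_⟩
  · intro s hs; have := hlo.trans_le hs.1; positivity
  · exact continuousOn_const.div continuousOn_id fun s (hs : s ∈ Icc lo hi) => (hlo.trans_le hs.1).ne'
  have ha0 : 0 < a := hlo.trans_le ha.1
  have hhi0 : 0 < hi := hlo.trans_le hlohi
  have hmono : ∀ s ∈ Icc a hi, Rχ ^ 2 / s ≤ Rχ ^ 2 / a := fun s hs =>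
    div_le_div_of_nonneg_left (sq_nonneg _) ha0 hs.1
  have hint : ∫ s in a..hi, Rχ ^ 2 / s ≤ ∫ s in a..hi, Rχ ^ 2 / a := by
    refine intervalIntegral.integral_mono_on ha.2 ?_ ?_ hmono
    · exact ((continuousOn_const.div continuousOn_id fun s (hs : s ∈ Icc a hi) => (ha0.trans_le hs.1).ne').mono
        (by rw [uIcc_of_le ha.2])).intervalIntegrable
    · exact intervalIntegrable_const
  rw [intervalIntegral.integral_const, smul_eq_mul] at hint
  have hrhs : (hi - a) * (Rχ ^ 2 / a) ≤ Rχ ^ 2 * hi ^ 2 / lo ^ 3 * (lo * (lo / a) ^ 2) := by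
    have h1 : (hi - a) * (Rχ ^ 2 / a) ≤ hi * (Rχ ^ 2 / a) := mul_le_mul_of_nonneg_right (by linarith) (by positivity)
    have h2 : hi * (Rχ ^ 2 / a) = Rχ ^ 2 * hi ^ 2 / lo ^ 3 * (lo * (lo / a) ^ 2) * (a / hi) := by
      field_simp
    have h3 : Rχ ^ 2 * hi ^ 2 / lo ^ 3 * (lo * (lo / a) ^ 2) * (a / hi) ≤ Rχ ^ 2 * hi ^ 2 / lo ^ 3 * (lo * (lo / a) ^ 2) * 1 :=
      mul_le_mul_of_nonneg_left ((div_le_one hhi0).2 ha.2) (by positivity)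
    linarith
  exact hint.trans hrhs

/-! ## §2 The bumped far piece -/

section Bump

variable {β Λ : ℝ} (hβ : 0 < β) (hΛ : 0 < Λ) {B₁ B₂ B₃ : ℝ} (hB₁ : ∀ x, |deriv salmhoferCutoff x| ≤ B₁) (hB₂ : ∀ x, |deriv (deriv salmhoferCutoff) x| ≤ B₂)
  (hB₃ : ∀ x, |deriv (deriv (deriv salmhoferCutoff)) x| ≤ B₃)
  {κ κ' κ'' : ℝ → ℝ} (hκ : ∀ t, HasDerivAt κ (κ' t) t) (hκ' : ∀ t, HasDerivAt κ' (κ'' t) t) (hκ''c : Continuous κ'')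
  {κ₀ κ₁ κ₂ : ℝ} (hκb : ∀ t ∈ Icc 0 1, |κ t| ≤ κ₀) (hκ'b : ∀ t ∈ Icc 0 1, |κ' t| ≤ κ₁) (hκ''b : ∀ t ∈ Icc 0 1, |κ'' t| ≤ κ₂)
  {t₁ : ℝ} (ht₀ : 0 < t₁) (ht25 : t₁ ≤ 2 / 5)
  (hκs : ∀ t, t₁ ≤ t → κ t = 0) (hκ's : ∀ t, t₁ ≤ t → κ' t = 0) (hκ''s : ∀ t, t₁ ≤ t → κ'' t = 0)
  {lo hi C : ℝ} (hlo : 0 < lo) (hloΛ : lo ≤ Λ) (hC : 0 < C)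
  {χ : ℝ → ℝ} (hχ : ContDiff ℝ 2 χ) {Bχ₁ Bχ₂ rχ Rχ Cχ : ℝ} (hχ0 : ∀ u, |χ u| ≤ 1) (hχ1 : ∀ u, |deriv χ u| ≤ Bχ₁)
  (hχ2 : ∀ u, |deriv (deriv χ) u| ≤ Bχ₂) (hχ1r : ∀ u, |u| ≤ rχ → deriv χ u = 0) (hrχ : 0 < rχ) (hχ1z : ∀ u, Rχ ≤ |u| → deriv χ u = 0)
  (hχ2z : ∀ u, Rχ ≤ |u| → deriv (deriv χ) u = 0) (hhiR : hi ≤ Rχ) (hCχ : 1 + 2 * Bχ₁ * Rχ + Bχ₂ * Rχ ^ 2 ≤ Cχ)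

set_option maxHeartbeats 800000 in
include hβ hΛ hB₁ hB₂ hB₃ hκ hκ' hκ''c hκb hκ'b hκ''b ht₀ ht25 hκs hκ's hκ''s hlo hloΛ hC hχ hχ0 hχ1 hχ2 hχ1r hrχ hχ1z hχ2z hhiR hCχ in
/-- **THE FOURTEEN KERNEL ROWS OF U7 FOR THE BUMPED FAR PIECE `χ(u)·(A_s(e,u)/C)/Cχ`** in the binder order and shapes of `umkLoopCircle_integral_le_canonical`
(`hKd, hK2d, hK0, hK0s, hK1, hK2, hsupp, hKc, hflat, hKn1, hρ0, hρc, hρtail, hKs1`); see the module docstring for the constants. [cite: BenfattoGiulianiMastropietro2006, §2.4 (2.36)] -/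
theorem ppFarKernelSBump_rows (hC0 : κ₀ * (12 * B₁ + 9) ≤ C) (hC1 : κ₀ * (64 * B₂ + 108 * B₁ + 145) + κ₁ * (12 * B₁ + 9) ≤ C)
    (hC2 : κ₀ * (256 * B₃ + 800 * B₂ + 2592 * B₁ + 1630) + 2 * κ₁ * (64 * B₂ + 108 * B₁ + 145) + (12 * B₁ + 9) * (κ₂ + 3 * κ₁) ≤ C)
    (hCs : κ₀ * (128 * B₁ + 72) + 8 * κ₁ ≤ C) (hlohi : lo ≤ hi) {wt : ℝ → ℝ} {W W' : ℝ} (hwc : ContinuousOn wt (Icc (-hi) hi))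
    (hw0 : ∀ e ∈ Icc (-hi) hi, 0 ≤ wt e) (hwW : ∀ e ∈ Icc (-hi) hi, wt e ≤ W) (hW' : 0 ≤ W') (hwL : ∀ e ∈ Icc lo hi, |wt e - wt lo| ≤ W' * (e - lo)) :
    (∀ e ∈ Icc (-hi) hi, ContDiff ℝ 1 (fun v : ℝ => χ v * (ppFarKernelS β Λ κ lo e v / C) / Cχ)) ∧
    (∀ e ∈ Icc lo hi, ContDiff ℝ 2 (fun v : ℝ => χ v * (ppFarKernelS β Λ κ lo e v / C) / Cχ)) ∧
    (∀ e ∈ Icc (-hi) hi, e ≠ 0 → ∀ u, |χ u * (ppFarKernelS β Λ κ lo e u / C) / Cχ| ≤ (max |e| |u|)⁻¹) ∧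
    (∀ e ∈ Icc (-lo) lo, ∀ u, |χ u * (ppFarKernelS β Λ κ lo e u / C) / Cχ| ≤ (max lo |u|)⁻¹) ∧
    (∀ e ∈ Icc (-hi) hi, e ≠ 0 → ∀ u, |deriv (fun v : ℝ => χ v * (ppFarKernelS β Λ κ lo e v / C) / Cχ) u| ≤ (max |e| |u|)⁻¹ ^ 2) ∧
    (∀ e ∈ Icc lo hi, ∀ u, |iteratedDeriv 2 (fun v : ℝ => χ v * (ppFarKernelS β Λ κ lo e v / C) / Cχ) u| ≤ (max e |u|)⁻¹ ^ 3) ∧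
    (∀ e ∈ Icc lo hi, ∀ u, |u| ≤ (1 - t₁) / t₁ * e → deriv (fun v : ℝ => χ v * (ppFarKernelS β Λ κ lo e v / C) / Cχ) u = 0) ∧
    (Continuous fun p : ℝ × ℝ => deriv (fun v : ℝ => χ v * (ppFarKernelS β Λ κ lo p.1 v / C) / Cχ) p.2) ∧
    (∀ D : ℝ, 0 < D → D ≤ hi / t₁ → |∫ e in lo..hi, wt e * deriv (fun v : ℝ => χ v * (ppFarKernelS β Λ κ lo e v / C) / Cχ) (D - e)| ≤
      (W * (4 * (κ₀ * (64 * B₂ + 108 * B₁ + 145) + κ₁ * (12 * B₁ + 9)) * (Λ / lo) ^ 2 +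
            (κ₀ * ((6 * B₁ + 5 / 2) * (Λ / lo) + Λ / lo / (2 * (1 - t₁)) + 6 / (β * lo) + 1) + κ₁ * (1 / (2 * (1 - t₁)) + t₁ / (1 - t₁)))) / C) / Cχ * (lo / (max D lo) ^ 2) + (((W' + W * Bχ₁) * (κ₀ * (64 * B₂ + 108 * B₁ + 145) + κ₁ * (12 * B₁ + 9)) * t₁ ^ 2 / (1 - t₁) ^ 2 / C) + W * Bχ₁ * rχ⁻¹ * (hi - lo)) / Cχ) ∧
    (∀ s ∈ Icc lo hi, ∀ u, s / 2 ≤ u → |deriv (fun v : ℝ => χ v * (ppFarKernelS β Λ κ lo (-s) v / C) / Cχ) u| ≤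
      ((((64 * (κ₀ * (64 * B₂ + 120 * B₁ + 154) + κ₁ * (12 * B₁ + 9)) * Λ ^ 3 / (s + 2 * Λ) ^ 3 +
          (κ₀ * ((β * lo) ^ 2 + 2) + κ₁ * (β * lo + 1)) * Real.exp (-(β / 2 * s))) / C) + Bχ₁ * (Rχ ^ 2 / s)) / Cχ) * ((max (u - s) lo)⁻¹ ^ 2)) ∧
    (∀ s ∈ Icc lo hi, 0 ≤ ((((64 * (κ₀ * (64 * B₂ + 120 * B₁ + 154) + κ₁ * (12 * B₁ + 9)) * Λ ^ 3 / (s + 2 * Λ) ^ 3 +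
          (κ₀ * ((β * lo) ^ 2 + 2) + κ₁ * (β * lo + 1)) * Real.exp (-(β / 2 * s))) / C) + Bχ₁ * (Rχ ^ 2 / s)) / Cχ)) ∧
    (ContinuousOn (fun s : ℝ => ((((64 * (κ₀ * (64 * B₂ + 120 * B₁ + 154) + κ₁ * (12 * B₁ + 9)) * Λ ^ 3 / (s + 2 * Λ) ^ 3 +
          (κ₀ * ((β * lo) ^ 2 + 2) + κ₁ * (β * lo + 1)) * Real.exp (-(β / 2 * s))) / C) + Bχ₁ * (Rχ ^ 2 / s)) / Cχ)) (Icc lo hi)) ∧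
    (∀ a ∈ Icc lo hi, ∫ s in a..hi, ((((64 * (κ₀ * (64 * B₂ + 120 * B₁ + 154) + κ₁ * (12 * B₁ + 9)) * Λ ^ 3 / (s + 2 * Λ) ^ 3 +
          (κ₀ * ((β * lo) ^ 2 + 2) + κ₁ * (β * lo + 1)) * Real.exp (-(β / 2 * s))) / C) + Bχ₁ * (Rχ ^ 2 / s)) / Cχ) ≤ (((32 * (κ₀ * (64 * B₂ + 120 * B₁ + 154) + κ₁ * (12 * B₁ + 9)) * (Λ / lo) ^ 3 +
          32 * (κ₀ * ((β * lo) ^ 2 + 2) + κ₁ * (β * lo + 1)) / (β * lo) ^ 3) / C) + Bχ₁ * (Rχ ^ 2 * hi ^ 2 / lo ^ 3)) / Cχ * (lo * (lo / a) ^ 2)) ∧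
    (∀ e ∈ Icc (-lo) lo, ∀ u, |deriv (fun v : ℝ => χ v * (ppFarKernelS β Λ κ lo e v / C) / Cχ) u| ≤ (max lo |u|)⁻¹ ^ 2) := by
  have hB10 : 0 ≤ B₁ := salmhoferB₁_nonneg hB₁
  have hκ₀ : 0 ≤ κ₀ := (abs_nonneg _).trans (hκb 0 (left_mem_Icc.2 zero_le_one))
  have hκc : Continuous κ := continuous_iff_continuousAt.2 fun t => (hκ t).continuousAt
  have hκ'c : Continuous κ' := continuous_iff_continuousAt.2 fun t => (hκ' t).continuousAt
  have hχd : Differentiable ℝ χ := hχ.differentiable (by norm_num)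
  have hBχ1 : 0 ≤ Bχ₁ := (abs_nonneg _).trans (hχ1 0)
  have hC1χ : 1 ≤ Cχ := bumpNormalisation_one_le hχ1 hχ2 hlo hlohi hhiR hCχ
  have hCχ0 : 0 < Cχ := by linarith
  have h8 : 8 * κ₀ ≤ C := by nlinarith only [hC0, mul_nonneg hκ₀ hB10, hκ₀]
  have hsub : Icc lo hi ⊆ Icc (-hi) hi := Icc_subset_Icc (by linarith only [hlo, hlohi]) le_rfl
  have hwc' : ContinuousOn wt (Icc lo hi) := hwc.mono hsub
  have hwW' : ∀ e ∈ Icc lo hi, |wt e| ≤ W := fun e he => by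
    rw [abs_of_nonneg (hw0 e (hsub he))]; exact hwW e (hsub he)
  have hW0 : 0 ≤ W := (abs_nonneg _).trans (hwW' lo (left_mem_Icc.2 hlohi))
  obtain ⟨-, rK2d, rK0, rK1, rK2, rsupp, rKc, -, rKn1, rρ0, rρc, rρtail, rKs1⟩ :=
    ppFarKernelS_rows (hi := hi) hβ hΛ hB₁ hB₂ hB₃ hκ hκ' hκ''c hκb hκ'b hκ''b ht₀ ht25 hκs hκ's hκ''s hlo hloΛ hC hC0 hC1 hC2 hCs
      hlohi hwc hw0 hwW hW' hwL
  have rK0s := farSRow_hK0s (sκ := κ) hβ hΛ hκb hlo hloΛ hC h8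
  have rKd' : ∀ e ∈ Icc (-hi) hi, ContDiff ℝ 1 (fun v : ℝ => ppFarKernelS β Λ κ lo e v / C) := fun e _ =>
    ((contDiff_two_ppFarKernelS_u hβ hΛ hB₁ hB₂ hκ hκ' hκ''c hlo e).of_le (by norm_num)).div_const C
  have hKc0 : Continuous fun p : ℝ × ℝ => ppFarKernelS β Λ κ lo p.1 p.2 / C := (continuous_ppFarKernelS_value₂ hβ hκc hlo).div_const C
  have hKdiff : ∀ e, Differentiable ℝ (fun v : ℝ => ppFarKernelS β Λ κ lo e v / C) := fun e =>
    ((contDiff_two_ppFarKernelS_u hβ hΛ hB₁ hB₂ hκ hκ' hκ''c hlo e).div_const C).differentiable (by norm_num)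
  -- value vanishing on the support zone (for `hsupp`)
  have hsupp0 : ∀ e ∈ Icc lo hi, ∀ u, |u| ≤ (1 - t₁) / t₁ * e → ppFarKernelS β Λ κ lo e u / C = 0 := fun e he u hu => by
    have he0 : 0 < e := hlo.trans_le he.1
    have hq1 : (1 : ℝ) ≤ (1 - t₁) / t₁ := by rw [le_div_iff₀ ht₀]; linarith
    rw [ppFarKernelS_eq_zero_of_abs_le hlo ht₀ hκs hq1 le_rfl (by rwa [abs_of_pos he0]), zero_div]
  -- flatness at the modified weights `wt·χ(D−·)`
  have rflatχ : ∀ D : ℝ, 0 < D → D ≤ hi / t₁ →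
      |∫ e in lo..hi, (wt e * χ (D - e)) * deriv (fun v : ℝ => ppFarKernelS β Λ κ lo e v / C) (D - e)| ≤
        (W * (4 * (κ₀ * (64 * B₂ + 108 * B₁ + 145) + κ₁ * (12 * B₁ + 9)) * (Λ / lo) ^ 2 +
            (κ₀ * ((6 * B₁ + 5 / 2) * (Λ / lo) + Λ / lo / (2 * (1 - t₁)) + 6 / (β * lo) + 1) + κ₁ * (1 / (2 * (1 - t₁)) + t₁ / (1 - t₁)))) / C) * (lo / (max D lo) ^ 2) + ((W' + W * Bχ₁) * (κ₀ * (64 * B₂ + 108 * B₁ + 145) + κ₁ * (12 * B₁ + 9)) * t₁ ^ 2 / (1 - t₁) ^ 2 / C) := fun D hD hDle => by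
    have hwcD : ContinuousOn (fun e => wt e * χ (D - e)) (Icc lo hi) :=
      hwc'.mul ((hχ.continuous.comp (continuous_const.sub continuous_id)).continuousOn)
    have hwWD : ∀ e ∈ Icc lo hi, |wt e * χ (D - e)| ≤ W := fun e he => by
      rw [abs_mul]
      calc |wt e| * |χ (D - e)| ≤ W * 1 := mul_le_mul (hwW' e he) (hχ0 _) (abs_nonneg _) hW0
        _ = W := mul_one W
    have hwLD := lipschitzAnchor_mul_bump (lo := lo) (hi := hi) hχd hχ0 hχ1 hwW' hW' hwL hlohi D
    have hW'' : 0 ≤ W' + W * Bχ₁ := by positivity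
    have h := farS_hflat_row hβ hΛ hB₁ hB₂ hκ hκ'c hκb hκ'b ht₀ ht25 hκs hκ's hκ''s hlo hloΛ hlohi hwcD hwWD hW'' hwLD hD hDle
    have hfun : (fun e => (wt e * χ (D - e)) * deriv (fun v : ℝ => ppFarKernelS β Λ κ lo e v / C) (D - e)) =
        fun e => ((wt e * χ (D - e)) * deriv (fun v : ℝ => ppFarKernelS β Λ κ lo e v) (D - e)) / C := funext fun e => by
      rw [deriv_div_const]; ring
    rw [hfun, intervalIntegral.integral_div, abs_div, abs_of_pos hC, div_le_iff₀ hC]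
    refine h.trans (le_of_eq ?_)
    field_simp
  have H_flat := bumpKernel_hflat (C := Cχ) hχ hχ1 hχ1r hrχ hlo hlohi hC1χ rKd' hKc0 rKc rK0 hwc' hwW' rflatχ
  -- the negative-level rows
  have hKv : ∀ s ∈ Icc lo hi, ∀ u, |ppFarKernelS β Λ κ lo (-s) u / C| ≤ s⁻¹ := fun s hs u => by
    have hs0 : 0 < s := hlo.trans_le hs.1
    have h := rK0 (-s) ⟨by linarith [hs.2], by linarith [hs.1, hlo]⟩ (by linarith) u
    rw [abs_neg, abs_of_pos hs0] at h
    exact h.trans (inv_anti₀ hs0 (le_max_left _ _))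
  have H_Kn1 := bumpKernel_hKn1_cutoff (Cχ := Cχ) hχ hχ0 hχ1 hχ1r hχ1z hlo hlohi hhiR hC1χ hKdiff rKn1 hKv
  obtain ⟨hv0, hvc, hvtail⟩ := bump_ρv_rows (Rχ := Rχ) hlo hlohi
  obtain ⟨H_ρ0, H_ρc, H_ρtail⟩ := bumpKernel_hρ (C := Cχ) hBχ1 hCχ0 rρ0 rρc rρtail hv0 hvc hvtail
  refine ⟨bumpKernel_hKd (C := Cχ) hχ rKd', bumpKernel_hK2d (C := Cχ) hχ rK2d,
    bumpKernel_hK0 hχ0 hχ1 hχ2 hlo hlohi hhiR hCχ rK0, bumpKernel_hK0s hχ0 hχ1 hχ2 hlo hlohi hhiR hCχ rK0s,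
    bumpKernel_hK1 hχ hχ0 hχ1 hχ2 hχ1z hlo hlohi hhiR hCχ rKd' rK0 rK1,
    bumpKernel_hK2 hχ hχ0 hχ1 hχ2 hχ1z hχ2z hlo hlohi hhiR hCχ rK2d rK0 rK1 rK2,
    bumpKernel_hsupp (C := Cχ) hχ rKd' hsupp0 rsupp hlo, bumpKernel_hKc (C := Cχ) hχ hKdiff hKc0 rKc,
    H_flat, H_Kn1, H_ρ0, H_ρc, H_ρtail,
    bumpKernel_hKs1 hχ hχ0 hχ1 hχ2 hχ1z hlo hlohi hhiR hCχ rKd' rK0s rKs1⟩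

set_option maxHeartbeats 400000 in
include hβ hΛ hB₁ hB₂ hκ hκ' hκ''c hκb hκ'b ht₀ ht25 hκs hκ's hκ''s hlo hloΛ hC hχ hχ0 hχ1 hχ2 hχ1z hhiR hCχ in
/-- **THE SIX ROWS OF B-1 (vi) FOR THE BUMPED FAR PIECE** `χ(u)·(A_s(e,u)/C)/Cχ` (binder order `hKd, hKc, hK0, hK0s, hK1, hKs1` of `firstOrderLayer_abs_le`):
`ppFarKernelS_firstOrderRows` ∘ `bumpKernel_*`. [cite: BenfattoGiulianiMastropietro2006, §2.4 (2.36)] -/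
theorem ppFarKernelSBump_firstOrderRows (hC0 : κ₀ * (12 * B₁ + 9) ≤ C) (hC1 : κ₀ * (64 * B₂ + 108 * B₁ + 145) + κ₁ * (12 * B₁ + 9) ≤ C)
    (hCs : κ₀ * (128 * B₁ + 72) + 8 * κ₁ ≤ C) (hlohi : lo ≤ hi) :
    (∀ e ∈ Icc (-hi) hi, ContDiff ℝ 1 (fun v : ℝ => χ v * (ppFarKernelS β Λ κ lo e v / C) / Cχ)) ∧
    (Continuous fun p : ℝ × ℝ => deriv (fun v : ℝ => χ v * (ppFarKernelS β Λ κ lo p.1 v / C) / Cχ) p.2) ∧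
    (∀ e ∈ Icc (-hi) hi, e ≠ 0 → ∀ u, |χ u * (ppFarKernelS β Λ κ lo e u / C) / Cχ| ≤ (max |e| |u|)⁻¹) ∧
    (∀ e ∈ Icc (-lo) lo, ∀ u, |χ u * (ppFarKernelS β Λ κ lo e u / C) / Cχ| ≤ (max lo |u|)⁻¹) ∧
    (∀ e ∈ Icc (-hi) hi, e ≠ 0 → ∀ u, |deriv (fun v : ℝ => χ v * (ppFarKernelS β Λ κ lo e v / C) / Cχ) u| ≤ (max |e| |u|)⁻¹ ^ 2) ∧
    (∀ e ∈ Icc (-lo) lo, ∀ u, |deriv (fun v : ℝ => χ v * (ppFarKernelS β Λ κ lo e v / C) / Cχ) u| ≤ (max lo |u|)⁻¹ ^ 2) := by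
  have hκc : Continuous κ := continuous_iff_continuousAt.2 fun t => (hκ t).continuousAt
  obtain ⟨rKd, rKc, rK0, rK0s, rK1, rKs1⟩ :=
    ppFarKernelS_firstOrderRows (hi := hi) hβ hΛ hB₁ hB₂ hκ hκ' hκ''c hκb hκ'b ht₀ ht25 hκs hκ's hκ''s hlo hloΛ hC hC0 hC1 hCs
  have hKc0 : Continuous fun p : ℝ × ℝ => ppFarKernelS β Λ κ lo p.1 p.2 / C := (continuous_ppFarKernelS_value₂ hβ hκc hlo).div_const C
  have hKdiff : ∀ e, Differentiable ℝ (fun v : ℝ => ppFarKernelS β Λ κ lo e v / C) := fun e =>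
    ((contDiff_two_ppFarKernelS_u hβ hΛ hB₁ hB₂ hκ hκ' hκ''c hlo e).div_const C).differentiable (by norm_num)
  exact ⟨bumpKernel_hKd (C := Cχ) hχ rKd, bumpKernel_hKc (C := Cχ) hχ hKdiff hKc0 rKc,
    bumpKernel_hK0 hχ0 hχ1 hχ2 hlo hlohi hhiR hCχ rK0, bumpKernel_hK0s hχ0 hχ1 hχ2 hlo hlohi hhiR hCχ rK0s,
    bumpKernel_hK1 hχ hχ0 hχ1 hχ2 hχ1z hlo hlohi hhiR hCχ rKd rK0 rK1,
    bumpKernel_hKs1 hχ hχ0 hχ1 hχ2 hχ1z hlo hlohi hhiR hCχ rKd rK0s rKs1⟩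

end Bump

end Summit.HubbardSuperconductivity.HubbardSuperconductivity.Theorems.C4a

end
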